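import Summits.AtomisticToContinuum.Crystallization.Theses.PalmUnimodularRigidity
import Summits.AtomisticToContinuum.Crystallization.Theorems.MinimiserShells.Negative.LoadBearing
import Summits.AtomisticToContinuum.Crystallization.Theorems.ChargedEnergyGap.Negative.Unconditional
import Summits.AtomisticToContinuum.Crystallization.Theorems.PalmUnimodularRigidityMinimiserShellsNecessityLimit
import Summits.AtomisticToContinuum.Crystallization.Theorems.PalmUnimodularRigidityMinimiserShellsNecessityRobust
import Summits.AtomisticToContinuum.Crystallization.Theorems.PalmUnimodularRigidityMinimiserShellsNecessityBlocks
import Literature.Probability.Process.PointStationaryLaw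
import Literature.Probability.Process.LocallyMatches

/-!
# The crux implies the loosened hard-core periodic shell gap (stub `stub_necessity_sandwich`, N4)

Stub `stub_necessity_sandwich` (N4, necessity sandwich — the assembly) of line
`equilibrium-in-law-surgery` (reshape r6) of crux `MinimiserShells`
(stmt-AtomisticToContinuum-9225, route `PalmUnimodularRigidity`).

Statement.  If `MinimiserShells` holds (every minimising point-stationary hard-core law has a good
root shell almost surely), then for every `θ ∈ (0, 1/10]` and every `t > 0` there is `κ > 0` such
that every periodic configuration `Q` of `ℝ³` with `1/3`-separated point set and at least `t · #F`
motif sites that are LOOSELY badly shelled in `Q.points` (tolerance `a/100 + θ`, radius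
`(5/4 − θ)·a`) has `e(Q) ≥ e* + κ`.

Proof (contradiction along a failing sequence).  If not, for every `n` there is a violating `Q_n`
with `e(Q_n) < e* + 1/(n+1)`.  The blocks of N3 (`NecessityBlocks.stub_necessity_blocks`, slack
`ε_n = min (t/2) (1/(n+1))`) are finite injective `1/3`-separated configurations `y_n` of `M_n > 0`
points with loosely-bad fraction `≥ t − ε_n ≥ t/2` and `e* ≤ 𝓔(y_n)/M_n ≤ e(Q_n) + ε_n <
e* + 2/(n+1)` (`ChargedEnergyGapNegative.card_mul_eStar_le`), so `𝓔(y_n)/M_n → e*`.  The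
Benjamini–Schramm limit of N1 (`NecessityLimit.stub_necessity_limit`) along a subsequence `φ` is a
point-stationary probability law `P`, a.s. rooted `1/3`-hard-core, with `E_P[h] = lim 𝓔/M = e*`
(uniqueness of limits); by the crux (`minimiserShells_iff`) the root shell is `P`-a.s. GOOD.  Let `T`
be the closed hull of the loosely-bad hard-core configurations: the rooted `1/3`-hard-core `μ` that
are, at every radius `R` and tolerance `ε > 0`, locally `(R, ε)`-matched by some rooted
`1/3`-hard-core loosely-bad `ν`.  It contains every loosely-bad re-rooted `y_n`
(`locallyMatches_self`), it is closed under local approximation within the hard-core class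
(`LocallyMatches.trans`, `closed_hull`), and by the robustness of good shells N2
(`NecessityRobust.stub_necessity_robust`, with `IsRootedHardCore.eq_count_restrict_atoms`) it
contains no configuration with a good shell; hence `P(T) = 0` (`measure_hull_eq_zero`).  The
closed-set clause of N1 with `ρ = t/4` bounds the number of particles of `y_(φ j)` whose re-rooted
configuration lies in `T` by `(t/4)·M` eventually, while at least `(t/2)·M` of them are loosely bad,
hence in `T` (`card_le_card_hull`) — a contradiction (`false_of_limit`).
-/

noncomputable section

open MeasureTheory Filter
open scoped ENNReal Topology Classical

namespace Summit.AtomisticToContinuum.Crystallization.Theorems.PalmUnimodularRigidityMinimiserShells.NecessitySandwich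

open Literature.Probability.Process (IsRootedHardCore IsPointStationaryLaw LocallyMatches atoms
  locallyMatches_self)
open Literature.MathematicalPhysics.StatisticalMechanics (lennardJones interactionEnergy PeriodicConfiguration)
open Literature.Geometry.DiscreteGeometry (ShellCloseTo fccKissingPattern hcpKissingPattern)
open Summit.AtomisticToContinuum.Crystallization.Theses.PalmUnimodularRigidity (MinimiserShells)
open Summit.AtomisticToContinuum.Crystallization.Theorems.MinimiserShells.Negative.LoadBearing
  (eStar meanRootEnergy GoodShell minimiserShells_iff)
open Summit.AtomisticToContinuum.Crystallization.Theorems.MinimiserShells.Negative.Rootedness (E3)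

/-! ## Energies per particle -/

/-- The two inlined copies of `e* = ⨅_Q e_LJ(Q)` (the crux read-back `LoadBearing.eStar` and
`ChargedEnergyGapNegative.eStar`) agree definitionally. -/
theorem eStar_eq : eStar = ChargedEnergyGapNegative.eStar := rfl

/-- Squeeze: a real sequence pinched between `e*` and `e* + 2/(n+1)` tends to `e*`. -/
theorem tendsto_eStar_of_squeeze {a : ℕ → ℝ} (hlow : ∀ n, eStar ≤ a n)
    (hup : ∀ n : ℕ, a n ≤ eStar + 2 * (1 / ((n : ℝ) + 1))) : Tendsto a atTop (𝓝 eStar) := by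
  refine tendsto_of_tendsto_of_tendsto_of_le_of_le tendsto_const_nhds ?_ hlow hup
  have h := ((tendsto_one_div_add_atTop_nhds_zero_nat (𝕜 := ℝ)).const_mul (2 : ℝ)).const_add eStar
  rwa [mul_zero, add_zero] at h

/-! ## Re-rooted finite configurations are rooted hard-core configurations -/

/-- The counting measure of a `1/3`-separated finite configuration re-rooted at one of its points,
`count|((· - y i) '' range y)`, is a rooted `1/3`-hard-core configuration. -/
theorem isRootedHardCore_image_sub {N : ℕ} {y : Fin N → E3}
    (hsep : ∀ i j : Fin N, i ≠ j → (1 : ℝ) / 3 ≤ dist (y i) (y j)) (i : Fin N) :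
    IsRootedHardCore (1 / 3)
      ((Measure.count : Measure E3).restrict ((fun z => z - y i) '' Set.range y)) := by
  refine ⟨(fun z => z - y i) '' Set.range y, ⟨y i, ⟨i, rfl⟩, sub_self _⟩, ?_, rfl⟩
  rintro _ ⟨_, ⟨j, rfl⟩, rfl⟩ _ ⟨_, ⟨k, rfl⟩, rfl⟩ hne
  dsimp only at hne ⊢
  rw [dist_sub_right]
  exact hsep j k fun h => hne (by rw [h])

/-! ## The closed hull of a class of hard-core configurations

For a predicate `B` of configurations, the HULL of `B` is the set of rooted `1/3`-hard-core
configurations `μ` that are, at every radius `R` and every tolerance `ε > 0`, locally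
`(R, ε)`-matched by some rooted `1/3`-hard-core configuration `ν` with `B ν`.  It is written inline as
`{μ | IsRootedHardCore (1/3) μ ∧ ∀ R ε, 0 < ε → ∃ ν, IsRootedHardCore (1/3) ν ∧ B ν ∧
LocallyMatches R ε (atoms ν) (atoms μ)}`. -/

/-- Hard-core configurations satisfying `B` lie in the hull of `B` (`locallyMatches_self`). -/
theorem mem_hull_of_bad {B : Measure E3 → Prop} {μ : Measure E3} (hμ : IsRootedHardCore (1 / 3) μ)
    (hB : B μ) :
    μ ∈ {μ : Measure E3 | IsRootedHardCore (1 / 3) μ ∧ ∀ R ε : ℝ, 0 < ε →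
      ∃ ν : Measure E3, IsRootedHardCore (1 / 3) ν ∧ B ν ∧ LocallyMatches R ε (atoms ν) (atoms μ)} :=
  ⟨hμ, fun R ε (hε : 0 < ε) => ⟨μ, hμ, hB, locallyMatches_self hε.le (atoms μ) R⟩⟩

/-- **The hull is closed under local approximation within the hard-core class** (the hypothesis of
the closed-set clause of N1): a rooted `1/3`-hard-core `μ` that is `(R, ε)`-matched by members of the
hull at every scale is in the hull — match `μ` by a hull member `ν` at `(R + ε, ε/2)`, match `ν` by a
`B`-configuration `ν'` at `(R + ε, ε/2)`, and compose (`LocallyMatches.trans`). -/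
theorem closed_hull {B : Measure E3 → Prop} :
    ∀ μ : Measure E3, IsRootedHardCore (1 / 3) μ →
      (∀ R ε : ℝ, 0 < ε → ∃ ν ∈ {μ : Measure E3 | IsRootedHardCore (1 / 3) μ ∧ ∀ R ε : ℝ, 0 < ε →
          ∃ ν : Measure E3, IsRootedHardCore (1 / 3) ν ∧ B ν ∧ LocallyMatches R ε (atoms ν) (atoms μ)},
        LocallyMatches R ε (atoms ν) (atoms μ)) →
      μ ∈ {μ : Measure E3 | IsRootedHardCore (1 / 3) μ ∧ ∀ R ε : ℝ, 0 < ε →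
          ∃ ν : Measure E3, IsRootedHardCore (1 / 3) ν ∧ B ν ∧ LocallyMatches R ε (atoms ν) (atoms μ)} := by
  intro μ hμ h
  refine ⟨hμ, fun R ε hε => ?_⟩
  obtain ⟨ν, ⟨-, hνT⟩, hm⟩ := h (R + ε) (ε / 2) (half_pos hε)
  obtain ⟨ν', hν', hB, hm'⟩ := hνT (R + ε) (ε / 2) (half_pos hε)
  refine ⟨ν', hν', hB, ?_⟩
  have hc := hm'.trans (R := R) hm (half_pos hε).le (half_pos hε).le (by linarith) (by linarith)
  rwa [add_halves] at hc

/-- **Loosely-bad particles are hull particles**: for a `1/3`-separated finite configuration `y`,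
the indices `i` whose re-rooted configuration satisfies `B` inject into the indices whose re-rooted
configuration lies in the hull of `B` (`isRootedHardCore_image_sub`, `mem_hull_of_bad`). -/
theorem card_le_card_hull {B : Measure E3 → Prop} {N : ℕ} {y : Fin N → E3}
    (hsep : ∀ i j : Fin N, i ≠ j → (1 : ℝ) / 3 ≤ dist (y i) (y j)) :
    Nat.card {i : Fin N // B ((Measure.count : Measure E3).restrict ((fun z => z - y i) '' Set.range y))} ≤
      Nat.card {i : Fin N // (Measure.count : Measure E3).restrict ((fun z => z - y i) '' Set.range y) ∈
        {μ : Measure E3 | IsRootedHardCore (1 / 3) μ ∧ ∀ R ε : ℝ, 0 < ε →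
          ∃ ν : Measure E3, IsRootedHardCore (1 / 3) ν ∧ B ν ∧ LocallyMatches R ε (atoms ν) (atoms μ)}} := by
  refine Nat.card_le_card_of_injective
    (fun i => ⟨i.1, mem_hull_of_bad (isRootedHardCore_image_sub hsep i.1) i.2⟩) ?_
  rintro ⟨i, _⟩ ⟨j, _⟩ h
  have hij : i = j := congrArg Subtype.val h
  subst hij
  rfl

/-- **The hull is null under a law with a.s. good shells**, provided `B` is incompatible with good
shells along local matchings (robustness): if `GoodShell μ` and an `(R₀, ε₀)`-matching of the atoms
of a hard-core `ν` to those of `μ` exclude `B ν`, then a law a.s. carried by rooted `1/3`-hard-core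
configurations with good shells gives the hull of `B` measure zero (`ae_iff`, `measure_mono_null`). -/
theorem measure_hull_eq_zero {B : Measure E3 → Prop} {R₀ ε₀ : ℝ} (hε₀ : 0 < ε₀)
    (hrob : ∀ μ ν : Measure E3, IsRootedHardCore (1 / 3) μ → IsRootedHardCore (1 / 3) ν →
      LocallyMatches R₀ ε₀ (atoms ν) (atoms μ) → GoodShell μ → ¬ B ν)
    {P : Measure (Measure E3)} (hcore : ∀ᵐ μ ∂P, IsRootedHardCore (1 / 3) μ)
    (hgood : ∀ᵐ μ ∂P, GoodShell μ) :
    P {μ : Measure E3 | IsRootedHardCore (1 / 3) μ ∧ ∀ R ε : ℝ, 0 < ε →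
      ∃ ν : Measure E3, IsRootedHardCore (1 / 3) ν ∧ B ν ∧ LocallyMatches R ε (atoms ν) (atoms μ)} = 0 := by
  have h := ae_iff.1 (hcore.and hgood)
  refine measure_mono_null ?_ h
  rintro μ ⟨hμ, hT⟩ ⟨-, hg⟩
  obtain ⟨ν, hν, hB, hm⟩ := hT R₀ ε₀ hε₀
  exact hrob μ ν hμ hν hm hg hB

/-! ## Robustness of good shells (N2) in hull form -/

/-- **A good shell excludes loosely-bad local matchings** (N2 `NecessityRobust.stub_necessity_robust`
read on measures): if `μ` is a rooted `1/3`-hard-core configuration with a good root shell and the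
atoms of the rooted `1/3`-hard-core `ν` are `(2, θ/2)`-matched to the atoms of `μ`
(`0 < θ ≤ 1/10`), then `ν` is NOT loosely badly shelled at tolerance `θ` (both measures are the
counting measures of their atoms, `IsRootedHardCore.eq_count_restrict_atoms`). -/
theorem not_looseBad_of_goodShell {θ : ℝ} (hθ : 0 < θ) (hθ1 : θ ≤ 1 / 10) :
    ∀ μ ν : Measure E3, IsRootedHardCore (1 / 3) μ → IsRootedHardCore (1 / 3) ν →
      LocallyMatches 2 (θ / 2) (atoms ν) (atoms μ) → GoodShell μ →
      ¬ ¬ (∃ a : ℝ, 9 / 10 ≤ a ∧ a ≤ 1 ∧ ∃ T : Finset E3,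
            (↑T : Set E3) = {w : E3 | ν {w} ≠ 0 ∧ w ≠ 0 ∧ ‖w‖ ≤ (5 / 4 - θ) * a} ∧
            (ShellCloseTo (a / 100 + θ) T (Finset.image (fun v : E3 => a • v) fccKissingPattern) ∨
             ShellCloseTo (a / 100 + θ) T (Finset.image (fun v : E3 => a • v) hcpKissingPattern))) := by
  intro μ ν hμ hν hm hg hbad
  refine hbad ?_
  have h := NecessityRobust.stub_necessity_robust θ hθ hθ1 (θ / 2) (half_pos hθ) le_rfl (atoms μ) (atoms ν)
    hν.zero_mem_atoms hμ.atoms_separated hν.atoms_separated hm.symm (hμ.eq_count_restrict_atoms ▸ hg)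
  rw [← hν.eq_count_restrict_atoms] at h
  exact h

/-! ## The density contradiction -/

/-- **No law can be a.s. off the hull while charging it in density.**  Let `y n` (`M n > 0` points,
`1/3`-separated) be finite configurations in which at least `(t − ε n) · M n ≥ (t/2) · M n` particles
have re-rooted configuration satisfying `B`, and let `P`, `φ` satisfy the closed-set clause of N1.  If
the hull of `B` is `P`-null, this is absurd: the clause with `ρ = t/4` bounds the hull particles of
`y (φ j)` by `(t/4) · M` eventually, and every `B`-particle is a hull particle (`card_le_card_hull`). -/
theorem false_of_limit {B : Measure E3 → Prop} {M : ℕ → ℕ} {y : (n : ℕ) → Fin (M n) → E3} {φ : ℕ → ℕ}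
    {P : Measure (Measure E3)} {t : ℝ} (ht : 0 < t) (hM : ∀ n, 0 < M n)
    (hsep : ∀ n, ∀ i j : Fin (M n), i ≠ j → (1 : ℝ) / 3 ≤ dist (y n i) (y n j))
    (hPT : P {μ : Measure E3 | IsRootedHardCore (1 / 3) μ ∧ ∀ R ε : ℝ, 0 < ε →
      ∃ ν : Measure E3, IsRootedHardCore (1 / 3) ν ∧ B ν ∧ LocallyMatches R ε (atoms ν) (atoms μ)} = 0)
    (hT : ∀ T : Set (Measure E3),
      (∀ μ : Measure E3, IsRootedHardCore (1 / 3) μ →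
        (∀ R ε : ℝ, 0 < ε → ∃ ν ∈ T, LocallyMatches R ε (atoms ν) (atoms μ)) → μ ∈ T) →
      ∀ ρ : ℝ, (P T).toReal < ρ →
        ∀ᶠ j : ℕ in atTop, (Nat.card {i : Fin (M (φ j)) //
          ((Measure.count : Measure E3).restrict ((fun z => z - y (φ j) i) '' Set.range (y (φ j)))) ∈ T} : ℝ)
            ≤ ρ * (M (φ j) : ℝ))
    (ε : ℕ → ℝ) (hεle : ∀ n, ε n ≤ t / 2)
    (hbad : ∀ n, (t - ε n) * (M n : ℝ) ≤ (Nat.card {i : Fin (M n) //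
      B ((Measure.count : Measure E3).restrict ((fun z => z - y n i) '' Set.range (y n)))} : ℝ)) :
    False := by
  obtain ⟨j, hj⟩ := (hT _ (closed_hull (B := B)) (t / 4)
    (((congrArg ENNReal.toReal hPT).trans ENNReal.toReal_zero).trans_lt (by linarith))).exists
  have hincl := card_le_card_hull (B := B) (hsep (φ j))
  have key : (t - ε (φ j)) * (M (φ j) : ℝ) ≤ t / 4 * (M (φ j) : ℝ) :=
    (hbad (φ j)).trans (((Nat.cast_le (α := ℝ)).2 hincl).trans hj)
  have hMpos : (0 : ℝ) < M (φ j) := Nat.cast_pos.2 (hM _)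
  have h1 : t / 2 * (M (φ j) : ℝ) ≤ (t - ε (φ j)) * (M (φ j) : ℝ) :=
    mul_le_mul_of_nonneg_right (by linarith [hεle (φ j)]) hMpos.le
  have h2 : 0 < t * (M (φ j) : ℝ) := mul_pos ht hMpos
  linarith

/-! ## The stub -/

/-- **Stub `stub_necessity_sandwich` (N4) of line `equilibrium-in-law-surgery` (reshape r6) of crux
`MinimiserShells` (stmt-AtomisticToContinuum-9225).**  THE CRUX IMPLIES THE HARD-CORE PERIODIC SHELL
GAP WITH ANY MARGINALLY LOOSER BAD-SHELL PREDICATE: if `MinimiserShells` holds then for every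
`θ ∈ (0, 1/10]` and `t > 0` there is `κ > 0` such that every `1/3`-hard-core periodic configuration
with at least `t · #F` motif sites that are not even loosely well shelled (tolerance `a/100 + θ`,
radius `(5/4 − θ)·a`) has `e(Q) ≥ e* + κ`.  Proof: a failing sequence `Q_n` (`κ = 1/(n+1)`), its
blocks (N3), their Benjamini–Schramm limit (N1) — a minimising point-stationary hard-core law, a.s.
good by the crux — and the `P`-null closed hull of the loosely-bad configurations (N2), charged in
density `≥ t/2` by the blocks: `false_of_limit`. -/
theorem stub_necessity_sandwich :
    MinimiserShells →
    ∀ θ : ℝ, 0 < θ → θ ≤ 1 / 10 → ∀ t : ℝ, 0 < t → ∃ κ : ℝ, 0 < κ ∧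
      ∀ Q : Literature.MathematicalPhysics.StatisticalMechanics.PeriodicConfiguration 3,
        (∀ p ∈ Q.points, ∀ q ∈ Q.points, p ≠ q → (1 : ℝ) / 3 ≤ dist p q) →
        t * (Q.motif.card : ℝ) ≤ (Nat.card {x : Q.motif // ¬ (∃ a : ℝ, 9 / 10 ≤ a ∧ a ≤ 1 ∧ ∃ T : Finset (EuclideanSpace ℝ (Fin 3)),
            (↑T : Set (EuclideanSpace ℝ (Fin 3))) = {w : EuclideanSpace ℝ (Fin 3) | ((Measure.count : Measure (EuclideanSpace ℝ (Fin 3))).restrict ((fun z => z - (x : EuclideanSpace ℝ (Fin 3))) '' Q.points)) {w} ≠ 0 ∧ w ≠ 0 ∧ ‖w‖ ≤ (5 / 4 - θ) * a} ∧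
            (Literature.Geometry.DiscreteGeometry.ShellCloseTo (a / 100 + θ) T
              (Finset.image (fun v : EuclideanSpace ℝ (Fin 3) => a • v) Literature.Geometry.DiscreteGeometry.fccKissingPattern) ∨
             Literature.Geometry.DiscreteGeometry.ShellCloseTo (a / 100 + θ) T
              (Finset.image (fun v : EuclideanSpace ℝ (Fin 3) => a • v) Literature.Geometry.DiscreteGeometry.hcpKissingPattern)))} : ℝ) →
        eStar + κ ≤ Q.energyPerParticle lennardJones := by
  intro hMS θ hθ hθ1 t ht
  by_contra H
  -- Step 0: a failing sequence `Q n` with `e(Q n) < e* + 1/(n+1)`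
  have hκ : ∀ n : ℕ, (0 : ℝ) < 1 / ((n : ℝ) + 1) := fun n => Nat.one_div_pos_of_nat
  have H1 := fun n : ℕ => not_forall.1 ((not_and.1 (not_exists.1 H (1 / ((n : ℝ) + 1)))) (hκ n))
  choose Q hQ using H1
  have hQsep := fun n => (Classical.not_imp.1 (hQ n)).1
  have hQbad := fun n => (Classical.not_imp.1 (Classical.not_imp.1 (hQ n)).2).1
  have hQe := fun n => not_le.1 (Classical.not_imp.1 (Classical.not_imp.1 (hQ n)).2).2
  -- Step 1: blocks (N3) with slack `ε n = min (t/2) (1/(n+1))`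
  have hε : ∀ n : ℕ, (0 : ℝ) < min (t / 2) (1 / ((n : ℝ) + 1)) := fun n => lt_min (half_pos ht) (hκ n)
  choose M hM y hyinj hysep hyE hybad using fun n : ℕ =>
    NecessityBlocks.stub_necessity_blocks θ hθ.le (Q n) (hQsep n) t (hQbad n) _ (hε n)
  -- Step 2: the energies per particle tend to `e*`
  have hlim : Tendsto (fun n : ℕ => interactionEnergy lennardJones (y n) / (M n : ℝ)) atTop (𝓝 eStar) := by
    refine tendsto_eStar_of_squeeze (fun n => ?_) (fun n => ?_)
    · show eStar ≤ interactionEnergy lennardJones (y n) / (M n : ℝ)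
      have hMpos : (0 : ℝ) < M n := Nat.cast_pos.2 (hM n)
      rw [le_div_iff₀ hMpos, eStar_eq]
      have hlow := ChargedEnergyGapNegative.card_mul_eStar_le (hyinj n)
      linarith
    · show interactionEnergy lennardJones (y n) / (M n : ℝ) ≤ eStar + 2 * (1 / ((n : ℝ) + 1))
      have hMpos : (0 : ℝ) < M n := Nat.cast_pos.2 (hM n)
      have h1 : (Q n).energyPerParticle lennardJones + min (t / 2) (1 / ((n : ℝ) + 1)) ≤
          eStar + 2 * (1 / ((n : ℝ) + 1)) := by
        linarith [hQe n, min_le_right (t / 2) (1 / ((n : ℝ) + 1))]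
      have h2 := mul_le_mul_of_nonneg_left h1 hMpos.le
      rw [div_le_iff₀ hMpos]
      linarith [hyE n]
  -- Step 3: the Benjamini–Schramm limit (N1); its mean root energy is `e*`
  obtain ⟨φ, hφ, P, hP, hcore, hstat, hE, hT⟩ :=
    NecessityLimit.stub_necessity_limit M y hM hyinj hysep
  have hmean : meanRootEnergy P = eStar := tendsto_nhds_unique hE (hlim.comp hφ.tendsto_atTop)
  -- Step 4: the crux makes the root shell a.s. good
  have hgood : ∀ᵐ μ ∂P, GoodShell μ :=
    minimiserShells_iff.1 hMS (1 / 3) (by norm_num) P hP hcore hstat hmean.le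
  -- Steps 5–6: the hull of the loosely-bad configurations is `P`-null, yet charged in density
  exact false_of_limit ht hM hysep
    (measure_hull_eq_zero (half_pos hθ) (not_looseBad_of_goodShell hθ hθ1) hcore hgood) hT
    (fun n : ℕ => min (t / 2) (1 / ((n : ℝ) + 1))) (fun n => min_le_left _ _) hybad

end Summit.AtomisticToContinuum.Crystallization.Theorems.PalmUnimodularRigidityMinimiserShells.NecessitySandwich

end
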